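import Summits.NavierStokesRegularity.NavierStokesRegularity.Theorems.SoloRefuteJormakka2010Datum
import Literature.Analysis.FluidPDE.ClassicalSolutionGalilean
import HarnessLib

/-!
# NS-claims map (cell `ns-claims`, D-0090), claim C02 `Jormakka2010`, part 2/2: the first failing step

J. Jormakka, *Solutions to three-dimensional Navier–Stokes equations for incompressible fluids*,
EJDE 2010 No. 93 (typed skeleton `Literature.Claims.NS.Jormakka2010`). Second of two files (part 1:
`SoloRefuteJormakka2010Datum.lean`: datum/gauge toolkit and the phase identity `key_identity`; gate lint ≤ 400 lines; filed for
ns-claims-refuter-2 by the cell's salvage prover under interim convention (b), content unchanged).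

Main result, for every `ν > 0`, `c ≠ 0`, `a > 0` (the print takes `c ≠ 0`, `a > 1`):
`not_step24UniqueLocal : ¬ Step24UniqueLocal ν c a` — the load-bearing step of the proof of
Theorem 2.4 (p. 5 l. 8–18: «every smooth space-periodic solution of the CLOSED-LOOP system
`∂ₜu + (u·∇)u = νΔu − ∇p + (∂ₜu − ∂ₜU)` on `[0,a)` with datum `u⁰` equals `U`») is false: the explicit
pair `(secondVelocity, secondPressure)`, `v(t,x) = e^{−βt} u⁰(x + h(t)𝟙) + g′(t)𝟙`,
`q = −e^{−2βt}|u⁰(x + h𝟙)|²/2 + g″(t)⟨𝟙,x⟩`, `h = g − (1/π)·arctan(2πg′/β)`, `β = (2π)²ν`, `g` the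
paper's own gauge, is a second classical closed-loop solution on `[0,a)` with the same datum, `v(·,t)`
lattice-periodic, and `v(a/2) ≠ U(a/2)` (countermodel proposed by referee ns-claims-ref-1 as a
phase-shifted Beltrami–Galilean solution; kernel-checked here through the phase identity
`key_identity`). Class: false lemma (countermodel). `not_forall_step24UniqueLocal` refutes the printed
parameter range uniformly. Axioms: `propext`, `Classical.choice`, `Quot.sound` only.
WHAT THIS IS NOT: not a claim about NS regularity or blow-up; not a claim about any author beyond the
typed locator.
-/

-- The summit's canonical theorem namespace repeats the summit name (single-conjunct summit).
set_option linter.dupNamespace false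

noncomputable section

open Real Set Function InnerProductSpace
open scoped RealInnerProductSpace ContDiff Laplacian Topology

namespace Summit.NavierStokesRegularity.NavierStokesRegularity.Theorems.Jormakka2010

open Literature.Analysis.FluidPDE Literature.Claims.NS.Jormakka2010


/-! ### The second closed-loop solution `(v, q)` on `[0, a)` -/

/-- The shift `h(t) = g(t) − (1/π)·arctan(2π g′(t)/β)`, `β = (2π)²ν`. -/
def shift (ν c a : ℝ) (t : ℝ) : ℝ :=
  blowupGauge c a t - arctan (2 * π * deriv (blowupGauge c a) t / ((2 * π) ^ 2 * ν)) / π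

/-- **The second solution** `v(t,y) = e^{−(2π)²νt} u⁰(y + h(t)𝟙) + g′(t)𝟙` (referee ns-claims-ref-1). -/
def secondVelocity (ν c a : ℝ) (t : ℝ) (y : EuclideanSpace ℝ (Fin 3)) : EuclideanSpace ℝ (Fin 3) :=
  exp (-((2 * π) ^ 2 * ν * t)) • datum (y + shift ν c a t • ones) + deriv (blowupGauge c a) t • ones

/-- Its pressure `q(t,y) = −½ e^{−2(2π)²νt} |u⁰(y + h(t)𝟙)|² + g″(t)(y₁ + y₂ + y₃)`. -/
def secondPressure (ν c a : ℝ) (t : ℝ) (y : EuclideanSpace ℝ (Fin 3)) : ℝ :=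
  -(exp (-((2 * π) ^ 2 * ν * t)) ^ 2) * (‖datum (y + shift ν c a t • ones)‖ ^ 2 / 2) +
    ⟪deriv (deriv (blowupGauge c a)) t • ones, y⟫

/-- The point at which `v(a/2)` and `U(a/2)` are compared (first component). -/
def testPoint (H G : ℝ) : EuclideanSpace ℝ (Fin 3) := !₂[0, 1 / 4 - (H + G) / 2, -((H + G) / 2)]

/-- Component `1` of the test point. -/
@[simp] theorem testPoint_apply_one (H G : ℝ) : testPoint H G 1 = 1 / 4 - (H + G) / 2 := by
  simp [testPoint]

/-- Component `2` of the test point. -/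
@[simp] theorem testPoint_apply_two (H G : ℝ) : testPoint H G 2 = -((H + G) / 2) := by
  simp [testPoint]

section Witness

variable (ν c a : ℝ)

/-- The phase-shifted gauge `h` is smooth on `t < a`. -/
theorem contDiffOn_shift : ContDiffOn ℝ ∞ (shift ν c a) (Iio a) := by
  unfold shift
  exact (contDiffOn_blowupGauge c a).sub
    ((contDiff_arctan.comp_contDiffOn
      ((contDiffOn_const.mul (contDiffOn_deriv_blowupGauge c a)).div_const _)).div_const _)

/-- `v` is jointly smooth on `(−∞, a) × EuclideanSpace ℝ (Fin 3)`. -/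
theorem contDiffOn_secondVelocity :
    ContDiffOn ℝ ∞ (uncurry (secondVelocity ν c a)) (Iio a ×ˢ univ) := by
  have hmaps : MapsTo (fun p : ℝ × EuclideanSpace ℝ (Fin 3) => p.1) (Iio a ×ˢ (univ : Set (EuclideanSpace ℝ (Fin 3)))) (Iio a) := fun p hp => hp.1
  have hsh : ContDiffOn ℝ ∞ (fun p : ℝ × EuclideanSpace ℝ (Fin 3) => shift ν c a p.1) (Iio a ×ˢ univ) :=
    (contDiffOn_shift ν c a).comp contDiffOn_fst hmaps
  have hk : ContDiffOn ℝ ∞ (fun p : ℝ × EuclideanSpace ℝ (Fin 3) => deriv (blowupGauge c a) p.1) (Iio a ×ˢ univ) :=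
    (contDiffOn_deriv_blowupGauge c a).comp contDiffOn_fst hmaps
  have he : ContDiff ℝ ∞ (fun p : ℝ × EuclideanSpace ℝ (Fin 3) => exp (-((2 * π) ^ 2 * ν * p.1))) :=
    (contDiff_const.mul contDiff_fst).neg.exp
  have hd : ContDiffOn ℝ ∞ (fun p : ℝ × EuclideanSpace ℝ (Fin 3) => datum (p.2 + shift ν c a p.1 • ones)) (Iio a ×ˢ univ) :=
    contDiff_datum.comp_contDiffOn (contDiffOn_snd.add (hsh.smul contDiffOn_const))
  exact (he.contDiffOn.smul hd).add (hk.smul contDiffOn_const)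

/-- `q` is jointly smooth on `(−∞, a) × EuclideanSpace ℝ (Fin 3)`. -/
theorem contDiffOn_secondPressure :
    ContDiffOn ℝ ∞ (uncurry (secondPressure ν c a)) (Iio a ×ˢ univ) := by
  have hmaps : MapsTo (fun p : ℝ × EuclideanSpace ℝ (Fin 3) => p.1) (Iio a ×ˢ (univ : Set (EuclideanSpace ℝ (Fin 3)))) (Iio a) := fun p hp => hp.1
  have hsh : ContDiffOn ℝ ∞ (fun p : ℝ × EuclideanSpace ℝ (Fin 3) => shift ν c a p.1) (Iio a ×ˢ univ) :=
    (contDiffOn_shift ν c a).comp contDiffOn_fst hmaps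
  have hk2 : ContDiffOn ℝ ∞ (fun p : ℝ × EuclideanSpace ℝ (Fin 3) => deriv (deriv (blowupGauge c a)) p.1) (Iio a ×ˢ univ) :=
    (contDiffOn_deriv_deriv_blowupGauge c a).comp contDiffOn_fst hmaps
  have he : ContDiff ℝ ∞ (fun p : ℝ × EuclideanSpace ℝ (Fin 3) => exp (-((2 * π) ^ 2 * ν * p.1))) :=
    (contDiff_const.mul contDiff_fst).neg.exp
  have hd : ContDiffOn ℝ ∞ (fun p : ℝ × EuclideanSpace ℝ (Fin 3) => datum (p.2 + shift ν c a p.1 • ones)) (Iio a ×ˢ univ) :=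
    contDiff_datum.comp_contDiffOn (contDiffOn_snd.add (hsh.smul contDiffOn_const))
  exact ((he.pow 2).neg.contDiffOn.mul ((hd.norm_sq ℝ).div_const 2)).add
    ((hk2.smul contDiffOn_const).inner ℝ contDiffOn_snd)

variable {a}

/-- Time slices of a field jointly smooth on `(−∞,a) × EuclideanSpace ℝ (Fin 3)` are differentiable in time. -/
theorem differentiableAt_slice {F : Type*} [NormedAddCommGroup F] [NormedSpace ℝ F]
    {w : ℝ → EuclideanSpace ℝ (Fin 3) → F} (hw : ContDiffOn ℝ ∞ (uncurry w) (Iio a ×ˢ univ)) {t : ℝ} (ht : t < a)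
    (y : EuclideanSpace ℝ (Fin 3)) : DifferentiableAt ℝ (fun s => w s y) t := by
  have h1 : DifferentiableAt ℝ (uncurry w) (t, y) :=
    (hw.differentiableOn (by simp)).differentiableAt
      ((isOpen_Iio.prod isOpen_univ).mem_nhds ⟨ht, mem_univ _⟩)
  have h2 : DifferentiableAt ℝ (fun s : ℝ => (s, y)) t :=
    differentiableAt_id.prodMk (differentiableAt_const y)
  exact h1.comp t h2

/-- The time factor `e(t) = exp(−(2π)²νt)` and its derivative. -/
theorem hasDerivAt_timeFactor (t : ℝ) :
    HasDerivAt (fun s => exp (-((2 * π) ^ 2 * ν * s)))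
      (exp (-((2 * π) ^ 2 * ν * t)) * (-((2 * π) ^ 2 * ν))) t := by
  have e : (fun s => exp (-((2 * π) ^ 2 * ν * s))) = fun s => exp (-((2 * π) ^ 2 * ν) * s) := by
    funext s
    rw [neg_mul]
  rw [e]
  refine (((hasDerivAt_id' t).const_mul (-((2 * π) ^ 2 * ν))).exp).congr_deriv ?_
  rw [mul_one, neg_mul]

/-- `∂ₜU(t, y)` for `t < a`. -/
theorem hasDerivAt_blowupVelocity {t : ℝ} (ht : t < a) (y : EuclideanSpace ℝ (Fin 3)) :
    HasDerivAt (fun s => blowupVelocity ν c a s y)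
      (exp (-((2 * π) ^ 2 * ν * t)) •
          fderiv ℝ datum (y + blowupGauge c a t • ones) (deriv (blowupGauge c a) t • ones) +
        (exp (-((2 * π) ^ 2 * ν * t)) * (-((2 * π) ^ 2 * ν))) • datum (y + blowupGauge c a t • ones) -
        deriv (deriv (blowupGauge c a)) t • ones) t := by
  have hfun : (fun s => blowupVelocity ν c a s y) = fun s =>
      exp (-((2 * π) ^ 2 * ν * s)) • datum (y + blowupGauge c a s • ones) -
        deriv (blowupGauge c a) s • ones := by
    funext s
    rw [show blowupVelocity ν c a s y = exp (-((2 * π) ^ 2 * ν * s)) •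
      initialField (y + blowupGauge c a s • ones) - deriv (blowupGauge c a) s • ones from rfl,
      initialField_eq_datum]
  have hg : HasDerivAt (blowupGauge c a) (deriv (blowupGauge c a) t) t :=
    (differentiableAt_blowupGauge c a ht).hasDerivAt
  have hγ : HasDerivAt (fun s => y + blowupGauge c a s • ones) (deriv (blowupGauge c a) t • ones) t :=
    (hg.smul_const ones).const_add y
  have hd : HasDerivAt (fun s => datum (y + blowupGauge c a s • ones))
      (fderiv ℝ datum (y + blowupGauge c a t • ones) (deriv (blowupGauge c a) t • ones)) t :=
    (differentiable_datum _).hasFDerivAt.comp_hasDerivAt t hγ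
  have hk : HasDerivAt (deriv (blowupGauge c a)) (deriv (deriv (blowupGauge c a)) t) t :=
    (differentiableAt_deriv_blowupGauge c a ht).hasDerivAt
  rw [hfun]
  exact ((hasDerivAt_timeFactor ν t).smul hd).sub (hk.smul_const ones)

/-- The Laplacian of a slice of `v`. -/
theorem laplacian_slice (E H K : ℝ) (y : EuclideanSpace ℝ (Fin 3)) :
    (Δ (fun w : EuclideanSpace ℝ (Fin 3) => E • datum (w + H • ones) + K • ones)) y = E • (Δ datum) (y + H • ones) := by
  have h0 : ContDiffAt ℝ 2 (fun w : EuclideanSpace ℝ (Fin 3) => datum (w + H • ones)) y :=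
    ((contDiff_datum (n := 2)).comp (contDiff_id.add contDiff_const)).contDiffAt
  have h1 : ContDiffAt ℝ 2 (fun w : EuclideanSpace ℝ (Fin 3) => E • datum (w + H • ones)) y := h0.const_smul E
  have h2 : ContDiffAt ℝ 2 (fun _ : EuclideanSpace ℝ (Fin 3) => K • ones) y := contDiffAt_const
  have e1 : (fun w : EuclideanSpace ℝ (Fin 3) => E • datum (w + H • ones) + K • ones) =
      (fun w : EuclideanSpace ℝ (Fin 3) => E • datum (w + H • ones)) + fun _ => K • ones := rfl
  have e2 : (fun w : EuclideanSpace ℝ (Fin 3) => E • datum (w + H • ones)) = E • fun w => datum (w + H • ones) := rfl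
  rw [e1, h1.laplacian_add h2, InnerProductSpace.laplacian_const, Pi.zero_apply, add_zero, e2,
    InnerProductSpace.laplacian_smul E h0, laplacian_comp_add_right]

/-- The space derivative of a slice of `v`. -/
theorem fderiv_slice (E H K : ℝ) (y : EuclideanSpace ℝ (Fin 3)) :
    fderiv ℝ (fun w : EuclideanSpace ℝ (Fin 3) => E • datum (w + H • ones) + K • ones) y =
      E • fderiv ℝ datum (y + H • ones) := by
  have hd : DifferentiableAt ℝ (fun w : EuclideanSpace ℝ (Fin 3) => datum (w + H • ones)) y :=
    (differentiable_datum _).comp y ((differentiableAt_id).add_const _)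
  rw [fderiv_add_const, fderiv_fun_const_smul hd, fderiv_comp_add_right]

/-- The gradient of a slice of `q`. -/
theorem gradient_slice (E H K2 : ℝ) (y : EuclideanSpace ℝ (Fin 3)) :
    gradient (fun w : EuclideanSpace ℝ (Fin 3) => -(E ^ 2) * (‖datum (w + H • ones)‖ ^ 2 / 2) + ⟪K2 • ones, w⟫) y =
      (-(E ^ 2)) • gradient (fun x => ‖datum x‖ ^ 2 / 2) (y + H • ones) + K2 • ones := by
  have hhalf : Differentiable ℝ (fun x : EuclideanSpace ℝ (Fin 3) => ‖datum x‖ ^ 2 / 2) := fun x =>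
    (hasFDerivAt_half_norm_sq (differentiable_datum x)).differentiableAt
  have hθ : Differentiable ℝ (fun x : EuclideanSpace ℝ (Fin 3) => -(E ^ 2) * (‖datum x‖ ^ 2 / 2)) :=
    (differentiable_const _).mul hhalf
  have h1 := gradient_comp_add_right_add_inner_sub_const hθ (H • ones) (K2 • ones) 0 y
  simp only [sub_zero] at h1
  rw [h1]
  congr 1
  unfold gradient
  rw [fderiv_const_mul (hhalf _)]
  simp

variable {ν c}

/-- **`(v, q)` is a classical solution of the CLOSED-LOOP system on `[0, a)`.** -/
theorem isClassicalNSSolutionOn_second (hν : ν ≠ 0) :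
    IsClassicalNSSolutionOn (Ico 0 a) ν (feedbackForce ν c a (secondVelocity ν c a))
      (secondVelocity ν c a) (secondPressure ν c a) where
  smooth_velocity := (contDiffOn_secondVelocity ν c a).mono (prod_mono Ico_subset_Iio_self le_rfl)
  smooth_pressure := (contDiffOn_secondPressure ν c a).mono (prod_mono Ico_subset_Iio_self le_rfl)
  momentum := by
    intro t ht y
    have ht0 : 0 ≤ t := ht.1
    have hta : t < a := ht.2
    -- abbreviations
    set E := exp (-((2 * π) ^ 2 * ν * t)) with hE
    set G := blowupGauge c a t with hG
    set K := deriv (blowupGauge c a) t with hK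
    set K2 := deriv (deriv (blowupGauge c a)) t with hK2
    set H := shift ν c a t with hH
    have hβ : (2 * π) ^ 2 * ν ≠ 0 := by positivity
    -- the slices
    have hv : secondVelocity ν c a t = fun w => E • datum (w + H • ones) + K • ones := rfl
    have hq : secondPressure ν c a t =
        fun w => -(E ^ 2) * (‖datum (w + H • ones)‖ ^ 2 / 2) + ⟪K2 • ones, w⟫ := rfl
    -- time derivatives: all equal to the two-sided derivative
    have hdv : DifferentiableAt ℝ (fun s => secondVelocity ν c a s y) t :=
      differentiableAt_slice (contDiffOn_secondVelocity ν c a) hta y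
    have h1 : timeDerivWithin (Ico 0 a) (secondVelocity ν c a) t y =
        deriv (fun s => secondVelocity ν c a s y) t := by
      rw [timeDerivWithin_apply]
      exact hdv.hasDerivAt.hasDerivWithinAt.derivWithin (uniqueDiffOn_Ico 0 a t ht)
    have h2 : timeDerivWithin (Ici 0) (secondVelocity ν c a) t y =
        deriv (fun s => secondVelocity ν c a s y) t := by
      rw [timeDerivWithin_apply]
      exact hdv.hasDerivAt.hasDerivWithinAt.derivWithin (uniqueDiffOn_Ici 0 t ht0)
    have h3 : timeDerivWithin (Ici 0) (blowupVelocity ν c a) t y =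
        E • fderiv ℝ datum (y + G • ones) (K • ones) + (E * (-((2 * π) ^ 2 * ν))) • datum (y + G • ones) -
          K2 • ones := by
      rw [timeDerivWithin_apply]
      exact (hasDerivAt_blowupVelocity ν c hta y).hasDerivWithinAt.derivWithin (uniqueDiffOn_Ici 0 t ht0)
    have hF : feedbackForce ν c a (secondVelocity ν c a) t y =
        timeDerivWithin (Ici 0) (secondVelocity ν c a) t y -
          timeDerivWithin (Ici 0) (blowupVelocity ν c a) t y := by
      show (if t < a then _ else _) = _
      rw [if_pos hta]
    -- space operators on the slices
    have hconv : convect (secondVelocity ν c a t) (secondVelocity ν c a t) y =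
        E • (E • gradient (fun x => ‖datum x‖ ^ 2 / 2) (y + H • ones) +
          K • fderiv ℝ datum (y + H • ones) ones) := by
      rw [convect_apply, hv, fderiv_slice, ← convect_datum, convect_apply]
      show E • (fderiv ℝ datum (y + H • ones)) (E • datum (y + H • ones) + K • ones) = _
      rw [map_add, map_smul, map_smul]
    have hlap : (Δ (secondVelocity ν c a t)) y = E • ((-((2 * π) ^ 2)) • datum (y + H • ones)) := by
      rw [hv, laplacian_slice, laplacian_datum]
    have hgrad : gradient (secondPressure ν c a t) y =
        (-(E ^ 2)) • gradient (fun x => ‖datum x‖ ^ 2 / 2) (y + H • ones) + K2 • ones := by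
      rw [hq, gradient_slice]
    -- the key identity at this time
    have hkey := key_identity hβ G K y
    have hsh : G - arctan (2 * π * K / ((2 * π) ^ 2 * ν)) / π = H := by
      rw [hH, hG, hK]
      rfl
    rw [hsh] at hkey
    rw [h1, hF, h2, h3, hconv, hlap, hgrad]
    ext i
    have hki := congrArg (fun v : EuclideanSpace ℝ (Fin 3) => v i) hkey
    simp only [PiLp.add_apply, PiLp.sub_apply, PiLp.smul_apply, smul_eq_mul, map_smul] at hki ⊢
    linear_combination E * hki
  divFree := by
    intro t ht y
    have hv : secondVelocity ν c a t =
        fun w => exp (-((2 * π) ^ 2 * ν * t)) • datum (w + shift ν c a t • ones) +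
          deriv (blowupGauge c a) t • ones := rfl
    unfold VectorCalculus.divergence
    rw [hv, fderiv_slice, ContinuousLinearMap.toLinearMap_smul, map_smul]
    have := isDivFree_datum (y + shift ν c a t • ones)
    unfold VectorCalculus.divergence at this
    rw [this, smul_zero]

/-- `v(0) = u⁰`. -/
theorem secondVelocity_zero (ha : a ≠ 0) : secondVelocity ν c a 0 = initialField := by
  funext y
  simp [secondVelocity, shift, blowupGauge_zero, deriv_blowupGauge_zero c ha, arctan_zero,
    initialField_eq_datum]

/-- `v(·, t)` is `ℤ³`-periodic. -/
theorem isLatticePeriodic_secondVelocity (t : ℝ) : IsLatticePeriodic (secondVelocity ν c a t) := by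
  intro j w
  show exp (-((2 * π) ^ 2 * ν * t)) • datum (w + EuclideanSpace.single j 1 + shift ν c a t • ones) +
      deriv (blowupGauge c a) t • ones = _
  rw [add_right_comm, isLatticePeriodic_datum j]
  rfl

/-- `v(a/2) ≠ U(a/2)` (first components at `testPoint` differ by `2g′(a/2) = 3c ≠ 0`). -/
theorem secondVelocity_ne (hc : c ≠ 0) (ha : a ≠ 0) :
    secondVelocity ν c a (a / 2) ≠ blowupVelocity ν c a (a / 2) := by
  intro heq
  set H := shift ν c a (a / 2) with hH
  set G := blowupGauge c a (a / 2) with hG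
  have hK : deriv (blowupGauge c a) (a / 2) = 3 * c / 2 := deriv_blowupGauge_half c ha
  have h := congrArg (fun v : EuclideanSpace ℝ (Fin 3) => v 0) (congrFun heq (testPoint H G))
  have hU : blowupVelocity ν c a (a / 2) (testPoint H G) =
      exp (-((2 * π) ^ 2 * ν * (a / 2))) • datum (testPoint H G + G • ones) -
        deriv (blowupGauge c a) (a / 2) • ones := by
    rw [show blowupVelocity ν c a (a / 2) (testPoint H G) = exp (-((2 * π) ^ 2 * ν * (a / 2))) •
      initialField (testPoint H G + blowupGauge c a (a / 2) • ones) -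
        deriv (blowupGauge c a) (a / 2) • ones from rfl, initialField_eq_datum]
  have hV : secondVelocity ν c a (a / 2) (testPoint H G) =
      exp (-((2 * π) ^ 2 * ν * (a / 2))) • datum (testPoint H G + H • ones) +
        deriv (blowupGauge c a) (a / 2) • ones := rfl
  simp only [hU, hV, hK, PiLp.add_apply, PiLp.sub_apply, PiLp.smul_apply, smul_eq_mul,
    datum_apply_zero, ones_apply, testPoint_apply_one, testPoint_apply_two, mul_one] at h
  have e1 : 2 * π * (1 / 4 - (H + G) / 2 + H) = π * (H - G) + π / 2 := by ring
  have e2 : 2 * π * (1 / 4 - (H + G) / 2 + G) = π / 2 - π * (H - G) := by ring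
  have e3 : 2 * π * (-((H + G) / 2) + H) = π * (H - G) := by ring
  have e4 : 2 * π * (-((H + G) / 2) + G) = -(π * (H - G)) := by ring
  rw [e1, e2, e3, e4, sin_add_pi_div_two, sin_pi_div_two_sub, cos_neg] at h
  apply hc
  linarith

end Witness

/-! ### Verdict theorems -/

/-- **Step 5 of `Jormakka2010` (p. 5 l. 8–18, local reading `Step24UniqueLocal`) is false** for every
`ν > 0`, `c ≠ 0`, `a > 0` (the print: `c ≠ 0`, `a > 1`): the closed-loop system on `[0,a)` with datum
`u⁰` has the second smooth space-periodic classical solution `secondVelocity ≠ U`. Class: false lemma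
(countermodel). WHAT THIS IS NOT: not a claim about NS regularity or blow-up; not a claim about any
author beyond the typed locator. -/
theorem not_step24UniqueLocal {ν c a : ℝ} (hν : 0 < ν) (hc : c ≠ 0) (ha : 0 < a) :
    ¬ Step24UniqueLocal ν c a := by
  intro h
  have hmem : a / 2 ∈ Ico 0 a := ⟨by linarith, by linarith⟩
  exact secondVelocity_ne hc ha.ne'
    (h _ _ (isClassicalNSSolutionOn_second hν.ne') (secondVelocity_zero ha.ne')
      (fun t _ => isLatticePeriodic_secondVelocity t) (a / 2) hmem)

/-- The printed parameter range (`ν > 0`, `c ≠ 0`, `a > 1`) of Step 5 is refuted uniformly. -/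
theorem not_forall_step24UniqueLocal :
    ¬ ∀ ν : ℝ, 0 < ν → ∀ c a : ℝ, c ≠ 0 → 1 < a → Step24UniqueLocal ν c a := fun h =>
  not_step24UniqueLocal one_pos one_ne_zero (by norm_num : (0 : ℝ) < 2) (h 1 one_pos 1 2 one_ne_zero
    (by norm_num))


end Summit.NavierStokesRegularity.NavierStokesRegularity.Theorems.Jormakka2010
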